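import Summits.ResolutionOfSingularities.ResolutionOfSingularities.Theorems.HilbertSamuelEliminationSigmaMaxModificationsCorridor3SigmaMenuGateTameHigh
import Summits.ResolutionOfSingularities.ResolutionOfSingularities.Theorems.HilbertSamuelEliminationSigmaMaxModificationsCorridor3SigmaHybridTopOfGroups
import HarnessLib

/-!
# [OURS · L1 W4.2] σ-LAYER — `Corridor3SigmaMenuGateRowP`: THE P-MODE OF THE TAME GATE (ENGINE-I «ROW-P», RULING v3.14-51 (51A)/(51C)): row modes
# `menu | rowP ℓ₀` with the E⁻/E⁺ EPOCH SPLIT read off the boundary's birth order, the gate combinator `GroupGate.byRowMode` (in a P-row every tame point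
# consults ONE row-wide prescription `rowP ℓ₀` — no per-point kind mixing), the centre gate `CentreGate.ofRecordP`, and the SWITCH LAW of (51A) as a
# statement-first run law on σ-chains with «no switching back» PROVED from it
# (cell res-hironaka, LADDER-RESOLUTION rung L; slot W4.2, crux chain w42 `SigmaMaxModifications` stmt-ResolutionOfSingularities-18506 / conjunct
# `SigmaMaxModificationsCorridor3` stmt-ResolutionOfSingularities-19249; res-L1-w42-plan-1 RULING v3.14-51 (51C) «(o1 g11) `GroupGate` P-MODE: the SWITCH LAW
# of (51A) as a gate law + P's centre classes served row-wide (`midWild` slot ↦ `rowP` mode; no per-point kind mixing inside a P-run; B6 = «labels are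
# birth times» + shared-centre silence) statement-first»; typer res-L1-type-o1 g11, CUT 20:09:03Z; `--supports stmt-…-19249 --as helper`, counted 0)

HONEST FRAMING. OURS design bookkeeping over this seat's gate files (`…SigmaMenuGate` p547638: `CentreGate`, `CornerReading`, `GroupGate`,
`CentreGate.ofCorners`, `GroupGate.ofRecordShapeKE`; `…SigmaMenuGateTame` p552890/p553779: `CentreGate.inf`, `CentreGate.tamePrescribed`; `…TameSplit`
p556753/p557523: `TameKindReading`, `tameByKind`, `PointReading`, `midSplit`; `…TameHigh` p558772/p559510: `tamePrescriptionOfRecord`, `CentreGate.ofRecordHigh`)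
and res-D-pv-060's chain vocabulary `IsChainFromσE` (`…SigmaHybridTopOfGroups`). The ROW-P prescription `rowP ℓ₀` is a PARAMETER — its instance is
res-L1-w42-idea-1's `…Corridor3SigmaRowRunP` (Cutkosky's procedure P: Thm 7.2 η-phase, (9), (10); centre classes read on `(T_{S₀}, 𝓑, E^±, η)`), the value
reading `sval` is res-L1-type-o2's (G2a), the MID-β test is `tk = mid ∧ ¬ sncSurface` of the split. NOTHING here is a statement of H. Hironaka's manuscript
[Hironaka2017] nor of Cutkosky / Cossart–Jannsen–Saito; no named fact. AI-typed; AI review is weaker than expert review.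

## Contents (namespace `…Theorems.SigmaMaxModificationsCorridor3.Sigma`)

* §1 `RowMode` (`menu` | `rowP ℓ₀`), `RowMode.IsP`; EPOCH SPLIT `Boundary.epochMinus E ℓ₀ := E.take ℓ₀` (E⁻ = the `ℓ₀` OLDEST members — «labels are birth times»
  IS the list order of `Boundary`) / `Boundary.epochPlus E ℓ₀ := E.drop ℓ₀` (E⁺); `epochMinus_next`/`epochPlus_next` (one blow-up: E⁻ ↦ strict transforms, E⁺
  gains the new member); readings `RowModeReading` (per state and ROW VALUE `S₀`), `RowValueReading` (`sval`), `RowAliveReading`.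
* §2 **`GroupGate.byRowMode sval mode menuCanon rowP`** (MENU ⇒ `menuCanon g C`; `rowP ℓ₀` ⇒ `rowP ℓ₀ g C` WHATEVER the tame kind of `g` — P owns the row),
  `byRowMode_isBPermissible`; **`GroupGate.tamePrescriptionP`** (MENU branch := `tamePrescriptionOfRecord …` p558772), **`CentreGate.ofRecordP`** (corner half of
  `ofRecordSplit` ⊓ `tamePrescribed tamePts (tamePrescriptionP …)`); `ofRecordP_iff_ofRecordHigh_of_forall_menu` (all rows MENU ⇒ the gate of record verbatim),
  `ofRecordP_rowP_apply` (SHARED-CENTRE SILENCE: every centre through a tame point of a P-row passes `rowP ℓ₀` there), `ofRecordP_exact` (P never touches `S = 0`).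
* §3 **SWITCH LAW (51A), statement-first** over `tamePts`, `sval`, `midβ : PointReading` (`tk = mid ∧ ¬ sncSurface`), `alive : RowAliveReading` (row `S₀` = the served
  top row): `HasMidBetaAt`, `AliveOn`, `IsTrigger`, **`IsFirstTrigger c S₀ n k`**, **`SwitchLaw σ N ν s₀ tamePts sval midβ alive mode`** (first trigger at `k ≤ n` ⇒
  `mode (c n) S₀ = rowP |E(c k)|`; none ⇒ `menu`). PROVED from it: `isFirstTrigger_unique`, `IsFirstTrigger.succ`, **`SwitchLaw.mode_succ_of_isP`** («NO SWITCHING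
  BACK»), `mode_eq_of_isP_of_aliveOn`, `mode_eq_menu_of_forall_not_hasMidBetaAt` (never (MID-β) ⇒ MENU: ENGINE-II certifies), `isP_of_hasMidBetaAt`.

VACUITY SELF-CHECK. Definitions + consequences proved from them. `byRowMode` is exactly as contentful as its two branches; `SwitchLaw` is satisfiable (the
reading defined by «first trigger» along chains satisfies it by construction once `mode` may depend on the run — on the scheme side the bit `ℓ₀` is carried in
the state's pending/labelling datum, instance with idea-1's `…RowRunP`) and not vacuous (a reading constantly `menu` violates it on any chain meeting a MID-β
point while its row is alive). The E^± split needs `ℓ₀ ≤ |E|`, which the law guarantees (`ℓ₀ = |E(c k)|`, `k ≤ n`, lengths grow: `IsChainFromσE.length_E_mono`, `SwitchLaw.length_le_of_isFirstTrigger`).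
-/

noncomputable section

set_option linter.dupNamespace false -- mandated namespace of this single-conjunct summit

open CategoryTheory AlgebraicGeometry TopologicalSpace
open Summit.ResolutionOfSingularities.ResolutionOfSingularities.Theorems.CampaignW42
open Literature.AlgebraicGeometry.Resolution Literature.RingTheory.HilbertSamuel

namespace Summit.ResolutionOfSingularities.ResolutionOfSingularities.Theorems.SigmaMaxModificationsCorridor3.Sigma

universe u

/-! ## §1. Row modes and the epoch split of the boundary -/

/-- [OURS · L1 W4.2] **THE MODE OF A TAME ROW** (RULING v3.14-51 (51A) SWITCH LAW): `menu` — the row is served by ENGINE-II (the four-way split of record);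
`rowP ℓ₀` — the row is a P-run (ENGINE-I, Cutkosky's procedure P) whose OLD epoch `E⁻` consists of the `ℓ₀` oldest boundary members (`E⁻ := 𝓑` of the
switch moment, `|𝓑| = ℓ₀`) and whose NEW epoch `E⁺` of the members born since. NOT a statement of the manuscript. [folklore] -/
inductive RowMode : Type
  | menu
  | rowP (ℓ₀ : ℕ)
  deriving DecidableEq

/-- [OURS · L1 W4.2] The row is in P-mode. [folklore] -/
def RowMode.IsP : RowMode → Prop
  | .menu => False
  | .rowP _ => True

/-- `menu` is not a P-mode. [folklore] -/
@[simp] theorem RowMode.not_isP_menu : ¬ RowMode.menu.IsP := fun h => h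

/-- `rowP ℓ₀` is a P-mode. [folklore] -/
@[simp] theorem RowMode.isP_rowP (ℓ₀ : ℕ) : (RowMode.rowP ℓ₀).IsP := trivial

section Epochs

variable {W : Scheme.{u}}

/-- [OURS · L1 W4.2] **THE OLD EPOCH `E⁻`** of a P-run switched on when the boundary had `ℓ₀` members: the `ℓ₀` OLDEST members (birth order = list order of
`Boundary`; «labels are birth times»). NOT a statement of the manuscript. [folklore] -/
def Boundary.epochMinus (E : Boundary W) (ℓ₀ : ℕ) : Boundary W :=
  E.take ℓ₀

/-- [OURS · L1 W4.2] **THE NEW EPOCH `E⁺`**: the members born since the switch. NOT a statement of the manuscript. [folklore] -/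
def Boundary.epochPlus (E : Boundary W) (ℓ₀ : ℕ) : Boundary W :=
  E.drop ℓ₀

/-- `E = E⁻ ++ E⁺`. [folklore] -/
theorem Boundary.epochMinus_append_epochPlus (E : Boundary W) (ℓ₀ : ℕ) : E.epochMinus ℓ₀ ++ E.epochPlus ℓ₀ = E :=
  List.take_append_drop ℓ₀ E

/-- `|E⁻| = ℓ₀` once `ℓ₀ ≤ |E|`. [folklore] -/
theorem Boundary.length_epochMinus {E : Boundary W} {ℓ₀ : ℕ} (h : ℓ₀ ≤ E.length) : (E.epochMinus ℓ₀).length = ℓ₀ := by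
  rw [Boundary.epochMinus, List.length_take, Nat.min_eq_left h]

/-- `|E⁺| = |E| − ℓ₀`. [folklore] -/
theorem Boundary.length_epochPlus (E : Boundary W) (ℓ₀ : ℕ) : (E.epochPlus ℓ₀).length = E.length - ℓ₀ :=
  List.length_drop

/-- At the switch moment (`ℓ₀ = |E|`): `E⁻ = E`, `E⁺ = []` («E⁻ := 𝓑 of that moment, E⁺ := ∅»). [folklore] -/
theorem Boundary.epochMinus_length (E : Boundary W) : E.epochMinus E.length = E := List.take_length

/-- … and `E⁺ = []`. [folklore] -/
theorem Boundary.epochPlus_length (E : Boundary W) : E.epochPlus E.length = [] := List.drop_length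

/-- **ONE BLOW-UP, OLD EPOCH**: with `ℓ₀ ≤ |E|` the old epoch of `E.next C` is the list of strict transforms of the old epoch of `E`. [folklore] -/
theorem Boundary.epochMinus_next {E : Boundary W} {ℓ₀ : ℕ} (h : ℓ₀ ≤ E.length) (C : W.IdealSheafData) :
    (E.next C).epochMinus ℓ₀ = (E.epochMinus ℓ₀).map (strictTransformIdeal (blowup.π C) C) := by
  rw [Boundary.epochMinus, Boundary.next, List.take_append_of_le_length (by rwa [List.length_map]), Boundary.epochMinus, List.map_take]

/-- **ONE BLOW-UP, NEW EPOCH**: the new epoch of `E.next C` is the strict transforms of the new epoch followed by the exceptional divisor. [folklore] -/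
theorem Boundary.epochPlus_next {E : Boundary W} {ℓ₀ : ℕ} (h : ℓ₀ ≤ E.length) (C : W.IdealSheafData) :
    (E.next C).epochPlus ℓ₀ = (E.epochPlus ℓ₀).map (strictTransformIdeal (blowup.π C) C) ++ [C.comap (blowup.π C)] := by
  rw [Boundary.epochPlus, Boundary.next, List.drop_append_of_le_length (by rwa [List.length_map]), Boundary.epochPlus, List.map_drop]

end Epochs

/-- [OURS · L1 W4.2] **A ROW-MODE READING**: the mode of the tame row of VALUE `S₀` at the state. NOT a statement of the manuscript. [folklore] -/
abbrev RowModeReading : Type (u + 1) :=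
  ∀ (W : Scheme.{u}), IsLocallyNoetherian W → ℕ → (ℕ → ℕ) → Labelling W → Option (Pending W) → Boundary W → ℕ → RowMode

/-- [OURS · L1 W4.2] **A ROW-VALUE READING** `S` at points (instance: res-L1-type-o2's (G2a) value reading — the residual order `S = ord N` on the contact
hypersurface at a tame point). NOT a statement of the manuscript. [folklore] -/
abbrev RowValueReading : Type (u + 1) :=
  ∀ (W : Scheme.{u}), IsLocallyNoetherian W → ℕ → (ℕ → ℕ) → Labelling W → Option (Pending W) → Boundary W → W → ℕ

/-- [OURS · L1 W4.2] **A ROW-ALIVE READING**: «the row of value `S₀` is the served (top) tame row at the state» (instance: `S₀ = max S` over the tame points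
of `X_max`, non-empty). NOT a statement of the manuscript. [folklore] -/
abbrev RowAliveReading : Type (u + 1) :=
  ∀ (W : Scheme.{u}), IsLocallyNoetherian W → ℕ → (ℕ → ℕ) → Labelling W → Option (Pending W) → Boundary W → ℕ → Prop

/-! ## §2. The gate in P-mode -/

/-- [OURS · L1 W4.2] **SLOT (iii) BY ROW MODE** (RULING v3.14-51 (51C) «`midWild` slot ↦ `rowP` mode; no per-point kind mixing inside a P-run»): at a tame
point `g` of row `S₀ := sval g` — if the row is in MENU mode consult `menuCanon` (the four-way split of record); if it is a P-run switched at boundary length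
`ℓ₀` consult the ROW-WIDE prescription `rowP ℓ₀` (Cutkosky's P on `(T_{S₀}, 𝓑, E⁻ = epochMinus ℓ₀, E⁺ = epochPlus ℓ₀, η)` — a parameter), WHATEVER the tame
kind of `g`. NOT a statement of the manuscript. [folklore] -/
def GroupGate.byRowMode (sval : RowValueReading.{u}) (mode : RowModeReading.{u}) (menuCanon : GroupGate.{u}) (rowP : ℕ → GroupGate.{u}) :
    GroupGate.{u} :=
  fun W hW N ν L P E g C =>
    match mode W hW N ν L P E (sval W hW N ν L P E g) with
    | .menu => menuCanon W hW N ν L P E g C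
    | .rowP ℓ₀ => rowP ℓ₀ W hW N ν L P E g C

section ByRowMode

variable {sval : RowValueReading.{u}} {mode : RowModeReading.{u}} {menuCanon : GroupGate.{u}} {rowP : ℕ → GroupGate.{u}} {N : ℕ} {ν : ℕ → ℕ}
  {W : Scheme.{u}} {hW : IsLocallyNoetherian W} {L : Labelling W} {P : Option (Pending W)} {E : Boundary W} {g : W} {C : W.IdealSheafData}

/-- In MENU mode the gate is the menu canon. [folklore] -/
theorem GroupGate.byRowMode_of_menu (h : mode W hW N ν L P E (sval W hW N ν L P E g) = .menu) :
    GroupGate.byRowMode sval mode menuCanon rowP W hW N ν L P E g C ↔ menuCanon W hW N ν L P E g C := by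
  simp only [GroupGate.byRowMode, h]

/-- In P-mode the gate is the row-wide prescription `rowP ℓ₀`, whatever the tame kind of the point. [folklore] -/
theorem GroupGate.byRowMode_of_rowP {ℓ₀ : ℕ} (h : mode W hW N ν L P E (sval W hW N ν L P E g) = .rowP ℓ₀) :
    GroupGate.byRowMode sval mode menuCanon rowP W hW N ν L P E g C ↔ rowP ℓ₀ W hW N ν L P E g C := by
  simp only [GroupGate.byRowMode, h]

/-- The mode split carries `𝓑`-permissibility whenever both branches do. [cite: CossartJannsenSaito2020, Def. 5.4] -/
theorem GroupGate.byRowMode_isBPermissible (hm : ∀ W hW N ν L P E g C, menuCanon W hW N ν L P E g C → IsBPermissible C E)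
    (hP : ∀ ℓ₀ W hW N ν L P E g C, rowP ℓ₀ W hW N ν L P E g C → IsBPermissible C E)
    (h : GroupGate.byRowMode sval mode menuCanon rowP W hW N ν L P E g C) : IsBPermissible C E := by
  revert h
  cases hk : mode W hW N ν L P E (sval W hW N ν L P E g) with
  | menu => rw [GroupGate.byRowMode_of_menu hk]; exact hm W hW N ν L P E g C
  | rowP ℓ₀ => rw [GroupGate.byRowMode_of_rowP hk]; exact hP ℓ₀ W hW N ν L P E g C

end ByRowMode

/-- [OURS · L1 W4.2] **THE TAME PRESCRIPTION WITH P-MODE**: `byRowMode` over the four-way split of record `tamePrescriptionOfRecord tk sncSurface germ γeS low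
midWild surface` (p558772) as the MENU branch and the ROW-P prescription `rowP` as the P branch. NOT a statement of the manuscript. [folklore] -/
def GroupGate.tamePrescriptionP (sval : RowValueReading.{u}) (mode : RowModeReading.{u}) (tk : TameKindReading.{u}) (sncSurface : PointReading.{u})
    (germ : TameGermReading.{u}) (γeS low midWild surface : GroupGate.{u}) (rowP : ℕ → GroupGate.{u}) : GroupGate.{u} :=
  GroupGate.byRowMode sval mode (GroupGate.tamePrescriptionOfRecord tk sncSurface germ γeS low midWild surface) rowP

/-- [OURS · L1 W4.2] **THE CENTRE GATE OF RECORD WITH P-MODE** (RULING v3.14-51): the corner half of `CentreGate.ofRecordSplit` (exact: member-face test ∧ `γe`;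
wild: face test) ⊓ the B3 tame gate `tamePrescribed tamePts (tamePrescriptionP …)`. NOT a statement of the manuscript. [folklore] -/
def CentreGate.ofRecordP (corners : CornerReading.{u}) (face : GroupGate.{u}) (kind : CornerKindReading.{u}) (γe : GroupGate.{u})
    (tamePts : CornerReading.{u}) (sval : RowValueReading.{u}) (mode : RowModeReading.{u}) (tk : TameKindReading.{u}) (sncSurface : PointReading.{u})
    (germ : TameGermReading.{u}) (γeS low midWild surface : GroupGate.{u}) (rowP : ℕ → GroupGate.{u}) : CentreGate.{u} :=
  CentreGate.inf (CentreGate.ofCorners corners (GroupGate.ofRecordShapeKE face kind γe fun _ _ _ _ _ _ _ _ _ => True))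
    (CentreGate.tamePrescribed tamePts (GroupGate.tamePrescriptionP sval mode tk sncSurface germ γeS low midWild surface rowP))

section RecordP

variable {corners tamePts : CornerReading.{u}} {face γe γeS low midWild surface : GroupGate.{u}} {kind : CornerKindReading.{u}} {tk : TameKindReading.{u}}
  {sncSurface : PointReading.{u}} {germ : TameGermReading.{u}} {sval : RowValueReading.{u}} {mode : RowModeReading.{u}} {rowP : ℕ → GroupGate.{u}}
  {N : ℕ} {ν : ℕ → ℕ} {W : Scheme.{u}} {hW : IsLocallyNoetherian W} {L : Labelling W} {P : Option (Pending W)} {E : Boundary W} {g : W}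
  {C : W.IdealSheafData}

/-- In MENU mode at `g` the P-mode prescription is the prescription of record. [folklore] -/
theorem GroupGate.tamePrescriptionP_of_menu (h : mode W hW N ν L P E (sval W hW N ν L P E g) = .menu) :
    GroupGate.tamePrescriptionP sval mode tk sncSurface germ γeS low midWild surface rowP W hW N ν L P E g C ↔
      GroupGate.tamePrescriptionOfRecord tk sncSurface germ γeS low midWild surface W hW N ν L P E g C :=
  GroupGate.byRowMode_of_menu h

/-- In P-mode at `g` the P-mode prescription is `rowP ℓ₀` — for EVERY tame kind of `g`. [folklore] -/
theorem GroupGate.tamePrescriptionP_of_rowP {ℓ₀ : ℕ} (h : mode W hW N ν L P E (sval W hW N ν L P E g) = .rowP ℓ₀) :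
    GroupGate.tamePrescriptionP sval mode tk sncSurface germ γeS low midWild surface rowP W hW N ν L P E g C ↔ rowP ℓ₀ W hW N ν L P E g C :=
  GroupGate.byRowMode_of_rowP h

/-- **ALL ROWS IN MENU ⇒ THE GATE OF RECORD VERBATIM** (`CentreGate.ofRecordHigh`, p558772). [folklore] -/
theorem CentreGate.ofRecordP_iff_ofRecordHigh_of_forall_menu (h : ∀ S₀, mode W hW N ν L P E S₀ = .menu) :
    CentreGate.ofRecordP corners face kind γe tamePts sval mode tk sncSurface germ γeS low midWild surface rowP W hW N ν L P E C ↔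
      CentreGate.ofRecordHigh corners face kind γe tamePts tk sncSurface germ γeS low midWild surface W hW N ν L P E C := by
  simp only [CentreGate.ofRecordP, CentreGate.ofRecordHigh, CentreGate.ofRecordSplit, CentreGate.inf_iff, CentreGate.tamePrescribed,
    CentreGate.ofCorners, GroupGate.tamePrescriptionP, GroupGate.byRowMode_of_menu (h _), GroupGate.tamePrescriptionOfRecord_eq]

/-- **SHARED-CENTRE SILENCE IN A P-ROW**: any centre passing the gate through a tame point `g` of a P-row (mode `rowP ℓ₀`) passes `rowP ℓ₀` at `g` — Q2 /
contact / surface proposals included: inside a P-run the row is owned by P. [folklore] -/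
theorem CentreGate.ofRecordP_rowP_apply
    (h : CentreGate.ofRecordP corners face kind γe tamePts sval mode tk sncSurface germ γeS low midWild surface rowP W hW N ν L P E C)
    (hg : g ∈ tamePts W hW N ν L P E) (hgC : g ∈ (C.support : Set W)) {ℓ₀ : ℕ} (hm : mode W hW N ν L P E (sval W hW N ν L P E g) = .rowP ℓ₀) :
    rowP ℓ₀ W hW N ν L P E g C :=
  (GroupGate.tamePrescriptionP_of_rowP hm).mp (h.2 g hg hgC)

/-- **P DOES NOT TOUCH `S = 0`**: at a live EXACT corner on the centre the gate is the member-face test and `γe`, as before. [folklore] -/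
theorem CentreGate.ofRecordP_exact
    (h : CentreGate.ofRecordP corners face kind γe tamePts sval mode tk sncSurface germ γeS low midWild surface rowP W hW N ν L P E C)
    (hg : g ∈ corners W hW N ν L P E) (hgC : g ∈ (C.support : Set W)) (hk : kind W hW N ν L P E g = .exact) :
    face W hW N ν L P E g C ∧ γe W hW N ν L P E g C :=
  (GroupGate.ofRecordShapeKE_of_exact hk).mp (h.1 g hg hgC)

/-- The P-mode gate carries `𝓑`-permissibility at tame points whenever the four MENU prescriptions and every `rowP ℓ₀` do. [cite: CossartJannsenSaito2020, Def. 5.4] -/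
theorem GroupGate.tamePrescriptionP_isBPermissible
    (hl : ∀ W hW N ν L P E g C, low W hW N ν L P E g C → IsBPermissible C E) (he : ∀ W hW N ν L P E g C, γeS W hW N ν L P E g C → IsBPermissible C E)
    (hw : ∀ W hW N ν L P E g C, midWild W hW N ν L P E g C → IsBPermissible C E)
    (hh : ∀ W hW N ν L P E g C, GroupGate.canonHigh germ W hW N ν L P E g C → IsBPermissible C E)
    (hs : ∀ W hW N ν L P E g C, surface W hW N ν L P E g C → IsBPermissible C E)
    (hP : ∀ ℓ₀ W hW N ν L P E g C, rowP ℓ₀ W hW N ν L P E g C → IsBPermissible C E)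
    (h : GroupGate.tamePrescriptionP sval mode tk sncSurface germ γeS low midWild surface rowP W hW N ν L P E g C) : IsBPermissible C E :=
  GroupGate.byRowMode_isBPermissible
    (fun _ _ _ _ _ _ _ _ _ h' => GroupGate.tameByKind_isBPermissible hl (fun _ _ _ _ _ _ _ _ _ => GroupGate.midSplit_isBPermissible he hw) hh hs
      ((GroupGate.tamePrescriptionOfRecord_eq (tk := tk) (sncSurface := sncSurface) (germ := germ) (γeS := γeS) (low := low) (midWild := midWild)
        (surface := surface)) ▸ h'))
    hP h

end RecordP

/-! ## §3. The SWITCH LAW of RULING v3.14-51 (51A), statement-first, and «no switching back» -/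

section Switch

variable (σ : StrategyE.{u}) (N : ℕ) (ν : ℕ → ℕ) (s₀ : MarkedStageE.{u}) (tamePts : CornerReading.{u}) (sval : RowValueReading.{u})
  (midβ : PointReading.{u}) (alive : RowAliveReading.{u}) (mode : RowModeReading.{u})

/-- [OURS · L1 W4.2] **A MID-β POINT OF ROW `S₀` AT THE STAGE `s`**: some tame point of value `S₀` is (MID-β) (`midβ` = «`tk = mid ∧ ¬ sncSurface`»). [folklore] -/
def HasMidBetaAt (s : MarkedStageE.{u}) (S₀ : ℕ) : Prop :=
  ∃ g ∈ tamePts s.W s.ln N ν s.L s.P s.E, sval s.W s.ln N ν s.L s.P s.E g = S₀ ∧ midβ s.W s.ln N ν s.L s.P s.E g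

/-- [OURS · L1 W4.2] **ROW `S₀` ALIVE ON `[k, n]`** along the chain `c` (the same row run). [folklore] -/
def AliveOn (c : ℕ → MarkedStageE.{u}) (S₀ k n : ℕ) : Prop :=
  ∀ j, k ≤ j → j ≤ n → alive (c j).W (c j).ln N ν (c j).L (c j).P (c j).E S₀

/-- [OURS · L1 W4.2] **A TRIGGER for row `S₀` at stage `n`**: a stage `k ≤ n` of the current row run carrying a MID-β point of the row. [folklore] -/
def IsTrigger (c : ℕ → MarkedStageE.{u}) (S₀ n k : ℕ) : Prop :=
  k ≤ n ∧ AliveOn N ν alive c S₀ k n ∧ HasMidBetaAt N ν tamePts sval midβ (c k) S₀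

/-- [OURS · L1 W4.2] **THE FIRST TRIGGER** (the switch moment): a trigger with no earlier trigger. [folklore] -/
def IsFirstTrigger (c : ℕ → MarkedStageE.{u}) (S₀ n k : ℕ) : Prop :=
  IsTrigger N ν tamePts sval midβ alive c S₀ n k ∧ ∀ k' < k, ¬ IsTrigger N ν tamePts sval midβ alive c S₀ n k'

/-- [OURS · L1 W4.2] **THE SWITCH LAW** (RULING v3.14-51 (51A)) for the mode reading `mode` along σ-chains from `s₀`: for every row value `S₀` and stage `n` —
if the current row run has met a MID-β point, first at stage `k`, the row is a P-run with `E⁻ := 𝓑(c k)` (`mode = rowP |E(c k)|`); otherwise the row is in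
MENU mode. «No switching back» and «MENU until the first (MID-β)» are CONSEQUENCES (below). NOT a statement of the manuscript. [folklore] -/
def SwitchLaw (σ : StrategyE.{u}) (N : ℕ) (ν : ℕ → ℕ) (s₀ : MarkedStageE.{u}) (tamePts : CornerReading.{u}) (sval : RowValueReading.{u})
    (midβ : PointReading.{u}) (alive : RowAliveReading.{u}) (mode : RowModeReading.{u}) : Prop :=
  ∀ c : ℕ → MarkedStageE.{u}, IsChainFromσE σ N ν s₀ c → ∀ S₀ n,
    (∀ k, IsFirstTrigger N ν tamePts sval midβ alive c S₀ n k →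
        mode (c n).W (c n).ln N ν (c n).L (c n).P (c n).E S₀ = .rowP (c k).E.length) ∧
      ((∀ k, ¬ IsFirstTrigger N ν tamePts sval midβ alive c S₀ n k) → mode (c n).W (c n).ln N ν (c n).L (c n).P (c n).E S₀ = .menu)

variable {σ N ν s₀ tamePts sval midβ alive mode} {c : ℕ → MarkedStageE.{u}} {S₀ n k k₁ k₂ : ℕ}

/-- Along a σ-chain the boundary grows by one member per step (`E ↦ E.next C`). [folklore] -/
theorem IsChainFromσE.length_E_succ (hc : IsChainFromσE σ N ν s₀ c) (n : ℕ) : (c (n + 1)).E.length = (c n).E.length + 1 := by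
  obtain ⟨C, P', hln, x', -, -, -, -, h⟩ := hc.2 n
  rw [h]
  exact Boundary.length_next (c n).E C

/-- … so boundary lengths are monotone along the chain (the epoch split `ℓ₀ = |E(c k)| ≤ |E(c n)|` is always available downstream). [folklore] -/
theorem IsChainFromσE.length_E_mono (hc : IsChainFromσE σ N ν s₀ c) {k n : ℕ} (hkn : k ≤ n) : (c k).E.length ≤ (c n).E.length := by
  induction n, hkn using Nat.le_induction with
  | base => exact le_rfl
  | succ m _ ih => exact ih.trans (by rw [hc.length_E_succ m]; exact Nat.le_succ _)

/-- Restricting an alive interval on the right. [folklore] -/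
theorem AliveOn.mono_right (h : AliveOn N ν alive c S₀ k n) {n' : ℕ} (hn' : n' ≤ n) : AliveOn N ν alive c S₀ k n' :=
  fun j hkj hjn => h j hkj (hjn.trans hn')

/-- Extending an alive interval by one alive stage. [folklore] -/
theorem AliveOn.succ (h : AliveOn N ν alive c S₀ k n)
    (hn : alive (c (n + 1)).W (c (n + 1)).ln N ν (c (n + 1)).L (c (n + 1)).P (c (n + 1)).E S₀) : AliveOn N ν alive c S₀ k (n + 1) := by
  intro j hkj hjn
  rcases Nat.lt_or_ge j (n + 1) with hlt | hge
  · exact h j hkj (Nat.lt_succ_iff.mp hlt)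
  · obtain rfl : j = n + 1 := le_antisymm hjn hge
    exact hn

/-- A trigger at stage `n` is a trigger at every later stage of the same row run. [folklore] -/
theorem IsTrigger.succ (h : IsTrigger N ν tamePts sval midβ alive c S₀ n k)
    (hn : alive (c (n + 1)).W (c (n + 1)).ln N ν (c (n + 1)).L (c (n + 1)).P (c (n + 1)).E S₀) :
    IsTrigger N ν tamePts sval midβ alive c S₀ (n + 1) k :=
  ⟨h.1.trans (Nat.le_succ n), h.2.1.succ hn, h.2.2⟩

/-- A trigger at stage `n + 1` with `k ≤ n` is a trigger at stage `n`. [folklore] -/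
theorem IsTrigger.of_succ (h : IsTrigger N ν tamePts sval midβ alive c S₀ (n + 1) k) (hk : k ≤ n) :
    IsTrigger N ν tamePts sval midβ alive c S₀ n k :=
  ⟨hk, h.2.1.mono_right (Nat.le_succ n), h.2.2⟩

/-- **Existence of a first trigger**: any trigger has a first trigger before it. [folklore] -/
theorem IsTrigger.exists_isFirstTrigger (h : IsTrigger N ν tamePts sval midβ alive c S₀ n k) :
    ∃ k₀ ≤ k, IsFirstTrigger N ν tamePts sval midβ alive c S₀ n k₀ := by
  classical
  have hex : ∃ k', IsTrigger N ν tamePts sval midβ alive c S₀ n k' := ⟨k, h⟩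
  refine ⟨Nat.find hex, Nat.find_min' hex h, Nat.find_spec hex, fun k' hk' => Nat.find_min hex hk'⟩

/-- **The first trigger is unique.** [folklore] -/
theorem isFirstTrigger_unique (h₁ : IsFirstTrigger N ν tamePts sval midβ alive c S₀ n k₁) (h₂ : IsFirstTrigger N ν tamePts sval midβ alive c S₀ n k₂) :
    k₁ = k₂ := by
  by_contra hne
  rcases Nat.lt_or_gt_of_ne hne with hlt | hgt
  · exact h₂.2 k₁ hlt h₁.1
  · exact h₁.2 k₂ hgt h₂.1

/-- **The first trigger persists** while the row stays alive: first at `n`, alive at `n + 1` ⇒ first at `n + 1`. [folklore] -/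
theorem IsFirstTrigger.succ (h : IsFirstTrigger N ν tamePts sval midβ alive c S₀ n k)
    (hn : alive (c (n + 1)).W (c (n + 1)).ln N ν (c (n + 1)).L (c (n + 1)).P (c (n + 1)).E S₀) :
    IsFirstTrigger N ν tamePts sval midβ alive c S₀ (n + 1) k :=
  ⟨h.1.succ hn, fun k' hk' h' => h.2 k' hk' (h'.of_succ ((Nat.le_of_lt hk').trans h.1.1))⟩

/-- Under the switch law, a first trigger at `k` puts the row in mode `rowP |E(c k)|` at stage `n`. [folklore] -/
theorem SwitchLaw.mode_eq_rowP (hlaw : SwitchLaw σ N ν s₀ tamePts sval midβ alive mode) (hc : IsChainFromσE σ N ν s₀ c)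
    (h : IsFirstTrigger N ν tamePts sval midβ alive c S₀ n k) :
    mode (c n).W (c n).ln N ν (c n).L (c n).P (c n).E S₀ = .rowP (c k).E.length :=
  (hlaw c hc S₀ n).1 k h

/-- Under the switch law the epoch split of a P-row fits inside the current boundary: `ℓ₀ ≤ |E(c n)|`. [folklore] -/
theorem SwitchLaw.length_le_of_isFirstTrigger (hc : IsChainFromσE σ N ν s₀ c) (h : IsFirstTrigger N ν tamePts sval midβ alive c S₀ n k) :
    (c k).E.length ≤ (c n).E.length :=
  hc.length_E_mono h.1.1

/-- **MENU UNTIL THE FIRST (MID-β)**: a row run with no MID-β point at any alive stage up to `n` is in MENU mode at `n` (ENGINE-II certifies it, (51B)).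
[folklore] -/
theorem SwitchLaw.mode_eq_menu_of_forall_not_hasMidBetaAt (hlaw : SwitchLaw σ N ν s₀ tamePts sval midβ alive mode) (hc : IsChainFromσE σ N ν s₀ c)
    (h : ∀ k ≤ n, AliveOn N ν alive c S₀ k n → ¬ HasMidBetaAt N ν tamePts sval midβ (c k) S₀) :
    mode (c n).W (c n).ln N ν (c n).L (c n).P (c n).E S₀ = .menu :=
  (hlaw c hc S₀ n).2 fun k hk => h k hk.1.1 hk.1.2.1 hk.1.2.2

/-- **A MID-β POINT SWITCHES THE ROW AT ONCE**: a MID-β point of an alive row at stage `n` ⇒ the row is a P-run at `n`. [folklore] -/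
theorem SwitchLaw.isP_of_hasMidBetaAt (hlaw : SwitchLaw σ N ν s₀ tamePts sval midβ alive mode) (hc : IsChainFromσE σ N ν s₀ c)
    (halive : alive (c n).W (c n).ln N ν (c n).L (c n).P (c n).E S₀) (h : HasMidBetaAt N ν tamePts sval midβ (c n) S₀) :
    (mode (c n).W (c n).ln N ν (c n).L (c n).P (c n).E S₀).IsP := by
  have htrig : IsTrigger N ν tamePts sval midβ alive c S₀ n n :=
    ⟨le_rfl, fun j hnj hjn => by obtain rfl : j = n := le_antisymm hjn hnj; exact halive, h⟩
  obtain ⟨k₀, -, hk₀⟩ := htrig.exists_isFirstTrigger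
  rw [hlaw.mode_eq_rowP hc hk₀]
  trivial

/-- Under the switch law a P-mode at stage `n` comes from a first trigger, and `ℓ₀` is that trigger's boundary length. [folklore] -/
theorem SwitchLaw.exists_isFirstTrigger_of_isP (hlaw : SwitchLaw σ N ν s₀ tamePts sval midβ alive mode) (hc : IsChainFromσE σ N ν s₀ c)
    (h : (mode (c n).W (c n).ln N ν (c n).L (c n).P (c n).E S₀).IsP) :
    ∃ k, IsFirstTrigger N ν tamePts sval midβ alive c S₀ n k ∧ mode (c n).W (c n).ln N ν (c n).L (c n).P (c n).E S₀ = .rowP (c k).E.length := by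
  by_contra hnone
  have hmenu : mode (c n).W (c n).ln N ν (c n).L (c n).P (c n).E S₀ = .menu :=
    (hlaw c hc S₀ n).2 fun k hk => hnone ⟨k, hk, hlaw.mode_eq_rowP hc hk⟩
  rw [hmenu] at h
  exact RowMode.not_isP_menu h

/-- [OURS · L1 W4.2] **NO SWITCHING BACK** (RULING v3.14-51 (51A) «stays P until the row dies»): under the switch law, a row in mode `rowP ℓ₀` at stage `n`
that is still alive at stage `n + 1` is in mode `rowP ℓ₀` at `n + 1` — same epoch split. PROVED from the law (the first trigger persists). NOT a statement of
the manuscript. [folklore] -/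
theorem SwitchLaw.mode_succ_of_isP (hlaw : SwitchLaw σ N ν s₀ tamePts sval midβ alive mode) (hc : IsChainFromσE σ N ν s₀ c) {ℓ₀ : ℕ}
    (h : mode (c n).W (c n).ln N ν (c n).L (c n).P (c n).E S₀ = .rowP ℓ₀)
    (halive : alive (c (n + 1)).W (c (n + 1)).ln N ν (c (n + 1)).L (c (n + 1)).P (c (n + 1)).E S₀) :
    mode (c (n + 1)).W (c (n + 1)).ln N ν (c (n + 1)).L (c (n + 1)).P (c (n + 1)).E S₀ = .rowP ℓ₀ := by
  obtain ⟨k, hk, hmode⟩ := hlaw.exists_isFirstTrigger_of_isP hc (by rw [h]; trivial)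
  rw [h] at hmode
  rw [hlaw.mode_eq_rowP hc (hk.succ halive), ← hmode]

/-- **Along an alive stretch the P-mode and its epoch split are constant.** [folklore] -/
theorem SwitchLaw.mode_eq_of_isP_of_aliveOn (hlaw : SwitchLaw σ N ν s₀ tamePts sval midβ alive mode) (hc : IsChainFromσE σ N ν s₀ c) {ℓ₀ : ℕ}
    (h : mode (c n).W (c n).ln N ν (c n).L (c n).P (c n).E S₀ = .rowP ℓ₀) {n' : ℕ} (hnn' : n ≤ n') (halive : AliveOn N ν alive c S₀ n n') :
    mode (c n').W (c n').ln N ν (c n').L (c n').P (c n').E S₀ = .rowP ℓ₀ := by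
  induction n', hnn' using Nat.le_induction with
  | base => exact h
  | succ m hnm ih =>
    exact hlaw.mode_succ_of_isP hc (ih (halive.mono_right (Nat.le_succ m))) (halive (m + 1) (hnm.trans (Nat.le_succ m)) le_rfl)

end Switch

end Summit.ResolutionOfSingularities.ResolutionOfSingularities.Theorems.SigmaMaxModificationsCorridor3.Sigma

end
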